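import Summits.ValiantsHypothesis.ValiantsHypothesis.Theorems.BarrierLeverAnchoredDoorHitsLowerPairsKernelLine

/-!
# Support item `AnchoredDoorHitsLowerPairs` (stmt-ValiantsHypothesis-22510), line `anchored-peeling`:
# KERNEL LINES FROM MINORS — the bridge from two nonzero maximal minors to the block-pairing lemma (gap m = 1)

Helper file (`--supports stmt-ValiantsHypothesis-22510`; cell valiant-natproofs, rung V4, 𝒟-side door (c); registered line
`Cruxes/AnchoredDoorHitsLowerPairs/Lines/anchored_peeling.lean` v13; prover seat val-np-p1 gen 19; blueprint HOME/val-np-p1/g19/QSTEP-BLUEPRINT ADDENDUM 2,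
step 3 of the GAP-ONE recipe). Pure linear algebra over an integral domain. Closes NO item.

Setting: a square matrix `S` indexed by `m`, row predicate `p` (the link rows), column predicate `q` (the columns avoiding the target), zero block `S[p,q] = 0`,
and REINDEXINGS of the two off-pattern blocks as Fin-matrices: the tall block `A = S[pᶜ, q] : (n+1) × n` and the wide block `E = S[p, qᶜ] : n′ × (n′+1)`.

* `det_ne_zero_of_blockPairing_line₀` — the rank-one block-pairing lemma with proportionality required at ONE coordinate `i₀` with `α i₀ ≠ 0`.
* `blockCofactorRow`, `blockCofactorCol` — the cofactor vectors of `A` and `E` (file `…KernelLine`) transported back to `m` and extended by zero.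
* `det_ne_zero_of_minors` — **if `A` has a nonzero maximal minor (some row deleted), `E` has a nonzero maximal minor (some column deleted), and the single
  ring element `blockCofactorRow ⬝ᵥ (S *ᵥ blockCofactorCol)` is nonzero, then `det S ≠ 0`.** In the gap-one UQ step the two minors are the hypotheses (H1), (H2)
  (symbolic minors of the deletion and link pairs) and the ring element is the cross value whose top coefficient module M3 computes.

WHAT THIS IS NOT: no statement about the door; nothing on crux stmt-ValiantsHypothesis-14610 or on `VP` versus `VNP`.
-/

set_option linter.dupNamespace false

open Matrix

namespace Summit.ValiantsHypothesis.ValiantsHypothesis.Theorems.BarrierLever.AnchoredPeeling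

section Minors

variable {A : Type*} [CommRing A] [IsDomain A] {m : Type*} [Fintype m] [DecidableEq m]

/-- **Block pairing, rank-one form, one anchor coordinate.** As `det_ne_zero_of_blockPairing_line`, but proportionality to `α` is only required at a single
coordinate `i₀` with `α i₀ ≠ 0`: `α i₀ • x = x i₀ • α`. -/
theorem det_ne_zero_of_blockPairing_line₀ (S : Matrix m m A) (p q : m → Prop) [DecidablePred p] [DecidablePred q]
    (hzero : ∀ i j, p i → q j → S i j = 0)
    (hE : ∀ z : m → A, (∀ i, ¬ p i → z i = 0) → z ᵥ* S = 0 → z = 0)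
    (α : m → A) (i₀ : m) (hα : α i₀ ≠ 0)
    (hline : ∀ x : m → A, (∀ i, p i → x i = 0) → (∀ j, q j → (x ᵥ* S) j = 0) → α i₀ • x = x i₀ • α)
    (y₀ : m → A) (hy₀q : ∀ j, q j → y₀ j = 0) (hy₀p : ∀ i, p i → (S *ᵥ y₀) i = 0) (hval : α ⬝ᵥ (S *ᵥ y₀) ≠ 0) :
    S.det ≠ 0 := by
  refine det_ne_zero_of_blockPairing S p q hzero hE (fun x hxp hxq hx0 => ⟨y₀, hy₀q, hy₀p, ?_⟩)
  have hprop := hline x hxp hxq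
  have hxi : x i₀ ≠ 0 := by
    intro hxi
    rw [hxi, zero_smul] at hprop
    apply hx0
    funext k
    have := congrFun hprop k
    simp only [Pi.smul_apply, smul_eq_mul, Pi.zero_apply] at this
    exact (mul_eq_zero.mp this).resolve_left hα
  intro hx
  have key : α i₀ * (x ⬝ᵥ (S *ᵥ y₀)) = x i₀ * (α ⬝ᵥ (S *ᵥ y₀)) := by
    rw [← smul_eq_mul, ← smul_eq_mul, ← smul_dotProduct, ← smul_dotProduct, hprop]
  rw [hx, mul_zero] at key
  exact (mul_ne_zero hxi hval) key.symm

variable (S : Matrix m m A) (p q : m → Prop) [DecidablePred p] [DecidablePred q] {n n' : ℕ}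
  (eA : {i : m // ¬ p i} ≃ Fin (n + 1)) (eQ : {j : m // q j} ≃ Fin n)
  (eP : {i : m // p i} ≃ Fin n') (eC : {j : m // ¬ q j} ≃ Fin (n' + 1))

/-- The tall block `S[pᶜ, q]` reindexed as an `(n+1) × n` Fin-matrix. -/
def tallBlock : Matrix (Fin (n + 1)) (Fin n) A := fun x y => S (eA.symm x).1 (eQ.symm y).1

/-- The wide block `S[p, qᶜ]` reindexed as an `n′ × (n′+1)` Fin-matrix. -/
def wideBlock : Matrix (Fin n') (Fin (n' + 1)) A := fun x y => S (eP.symm x).1 (eC.symm y).1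

/-- The row-cofactor vector of the tall block, transported to `m` and extended by zero on the `p`-rows. -/
def blockCofactorRow : m → A := fun i => if hi : p i then 0 else Matrix.rowCofactor (tallBlock S p q eA eQ) (eA ⟨i, hi⟩)

/-- The column-cofactor vector of the wide block, transported to `m` and extended by zero on the `q`-columns. -/
def blockCofactorCol : m → A := fun j => if hj : q j then 0 else Matrix.colCofactor (wideBlock S p q eP eC) (eC ⟨j, hj⟩)

omit [IsDomain A] [Fintype m] [DecidableEq m] [DecidablePred q] in
/-- `blockCofactorRow` vanishes on the `p`-rows. -/
theorem blockCofactorRow_of_pos {i : m} (hi : p i) : blockCofactorRow S p q eA eQ i = 0 := by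
  simp [blockCofactorRow, hi]

omit [IsDomain A] [Fintype m] [DecidableEq m] [DecidablePred q] in
/-- `blockCofactorRow` off the `p`-rows is the cofactor of the tall block. -/
theorem blockCofactorRow_of_neg {i : m} (hi : ¬ p i) :
    blockCofactorRow S p q eA eQ i = Matrix.rowCofactor (tallBlock S p q eA eQ) (eA ⟨i, hi⟩) := by
  simp [blockCofactorRow, hi]

omit [IsDomain A] [Fintype m] [DecidableEq m] [DecidablePred p] in
/-- `blockCofactorCol` vanishes on the `q`-columns. -/
theorem blockCofactorCol_of_pos {j : m} (hj : q j) : blockCofactorCol S p q eP eC j = 0 := by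
  simp [blockCofactorCol, hj]

omit [IsDomain A] [Fintype m] [DecidableEq m] [DecidablePred p] in
/-- `blockCofactorCol` off the `q`-columns is the cofactor of the wide block. -/
theorem blockCofactorCol_of_neg {j : m} (hj : ¬ q j) :
    blockCofactorCol S p q eP eC j = Matrix.colCofactor (wideBlock S p q eP eC) (eC ⟨j, hj⟩) := by
  simp [blockCofactorCol, hj]

omit [IsDomain A] [DecidableEq m] in
/-- Splitting a sum over `m` along a decidable predicate, as sums over the two subtypes. -/
private theorem sum_split (r : m → Prop) [DecidablePred r] (f : m → A) :
    ∑ i, f i = (∑ i : {i : m // r i}, f i.1) + ∑ i : {i : m // ¬ r i}, f i.1 :=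
  (Fintype.sum_subtype_add_sum_subtype r f).symm

omit [IsDomain A] [DecidableEq m] [DecidablePred q] in
/-- A vector supported off `p` that kills the `q`-columns of `S` gives a left-kernel vector of the tall block. -/
theorem vecMul_tallBlock_eq_zero (x : m → A) (hxp : ∀ i, p i → x i = 0) (hxq : ∀ j, q j → (x ᵥ* S) j = 0) :
    (fun t => x (eA.symm t).1) ᵥ* tallBlock S p q eA eQ = 0 := by
  funext y
  rw [Pi.zero_apply]
  have h := hxq (eQ.symm y).1 (eQ.symm y).2
  change ∑ i, x i * S i (eQ.symm y).1 = 0 at h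
  rw [sum_split p, Fintype.sum_eq_zero _ (fun i => by rw [hxp i.1 i.2, zero_mul]), zero_add] at h
  change ∑ t : Fin (n + 1), x (eA.symm t).1 * S (eA.symm t).1 (eQ.symm y).1 = 0
  rw [← h, ← eA.symm.sum_comp]

omit [IsDomain A] [DecidableEq m] [DecidablePred q] in
/-- A vector supported on `p` that kills `S` from the left gives a left-kernel vector of the wide block. -/
theorem vecMul_wideBlock_eq_zero (z : m → A) (hz : ∀ i, ¬ p i → z i = 0) (hzS : z ᵥ* S = 0) :
    (fun t => z (eP.symm t).1) ᵥ* wideBlock S p q eP eC = 0 := by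
  funext y
  rw [Pi.zero_apply]
  have h := congrFun hzS (eC.symm y).1
  rw [Pi.zero_apply] at h
  change ∑ i, z i * S i (eC.symm y).1 = 0 at h
  rw [sum_split p, Fintype.sum_eq_zero (fun i : {i : m // ¬ p i} => z i.1 * S i.1 (eC.symm y).1)
    (fun i => by rw [hz i.1 i.2, zero_mul]), add_zero] at h
  change ∑ t : Fin n', z (eP.symm t).1 * S (eP.symm t).1 (eC.symm y).1 = 0
  rw [← h, ← eP.symm.sum_comp]

omit [IsDomain A] [DecidableEq m] [DecidablePred q] in
/-- The extended row cofactor kills the `q`-columns of `S`. -/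
theorem blockCofactorRow_vecMul_of_pos {j : m} (hj : q j) : (blockCofactorRow S p q eA eQ ᵥ* S) j = 0 := by
  have h := congrFun (rowCofactor_vecMul (tallBlock S p q eA eQ)) (eQ ⟨j, hj⟩)
  rw [Pi.zero_apply] at h
  change ∑ t : Fin (n + 1), Matrix.rowCofactor (tallBlock S p q eA eQ) t * S (eA.symm t).1 (eQ.symm (eQ ⟨j, hj⟩)).1 = 0 at h
  rw [Equiv.symm_apply_apply] at h
  change ∑ i, blockCofactorRow S p q eA eQ i * S i j = 0
  rw [sum_split p, Fintype.sum_eq_zero (fun i : {i : m // p i} => blockCofactorRow S p q eA eQ i.1 * S i.1 j)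
    (fun i => by rw [blockCofactorRow_of_pos S p q eA eQ i.2, zero_mul]), zero_add,
    ← eA.symm.sum_comp (fun i : {i : m // ¬ p i} => blockCofactorRow S p q eA eQ i.1 * S i.1 j), ← h]
  refine Finset.sum_congr rfl (fun t _ => ?_)
  rw [blockCofactorRow_of_neg S p q eA eQ (eA.symm t).2]
  simp

omit [IsDomain A] [DecidableEq m] [DecidablePred p] in
/-- `S` applied to the extended column cofactor vanishes on the `p`-rows. -/
theorem mulVec_blockCofactorCol_of_pos {i : m} (hi : p i) : (S *ᵥ blockCofactorCol S p q eP eC) i = 0 := by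
  have h := congrFun (mulVec_colCofactor (wideBlock S p q eP eC)) (eP ⟨i, hi⟩)
  rw [Pi.zero_apply] at h
  change ∑ y : Fin (n' + 1), S (eP.symm (eP ⟨i, hi⟩)).1 (eC.symm y).1 * Matrix.colCofactor (wideBlock S p q eP eC) y = 0 at h
  rw [Equiv.symm_apply_apply] at h
  change ∑ j, S i j * blockCofactorCol S p q eP eC j = 0
  rw [sum_split q, Fintype.sum_eq_zero (fun j : {j : m // q j} => S i j.1 * blockCofactorCol S p q eP eC j.1)
    (fun j => by rw [blockCofactorCol_of_pos S p q eP eC j.2, mul_zero]), zero_add,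
    ← eC.symm.sum_comp (fun j : {j : m // ¬ q j} => S i j.1 * blockCofactorCol S p q eP eC j.1), ← h]
  refine Finset.sum_congr rfl (fun y _ => ?_)
  rw [blockCofactorCol_of_neg S p q eP eC (eC.symm y).2]
  simp

/-- **From two nonzero maximal minors to `det S ≠ 0`.** If the tall block has a nonzero minor avoiding row `x₀`, the wide block has a nonzero minor avoiding
column `y₀`, and the cross value `blockCofactorRow ⬝ᵥ (S *ᵥ blockCofactorCol)` is nonzero, then `det S ≠ 0`. -/
theorem det_ne_zero_of_minors (hzero : ∀ i j, p i → q j → S i j = 0)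
    (x₀ : Fin (n + 1)) (hA : ((tallBlock S p q eA eQ).submatrix x₀.succAbove id).det ≠ 0)
    (y₀ : Fin (n' + 1)) (hEmin : ((wideBlock S p q eP eC).submatrix id y₀.succAbove).det ≠ 0)
    (hval : blockCofactorRow S p q eA eQ ⬝ᵥ (S *ᵥ blockCofactorCol S p q eP eC) ≠ 0) :
    S.det ≠ 0 := by
  classical
  refine det_ne_zero_of_blockPairing_line₀ S p q hzero ?_ (blockCofactorRow S p q eA eQ) (eA.symm x₀).1 ?_ ?_
    (blockCofactorCol S p q eP eC) (fun j hj => blockCofactorCol_of_pos S p q eP eC hj)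
    (fun i hi => mulVec_blockCofactorCol_of_pos S p q eP eC hi) hval
  · -- the p-rows are independent: restrict to the columns of the wide block minus y₀
    intro z hz hzS
    have hw := vecMul_wideBlock_eq_zero S p q eP eC z hz hzS
    have hw' : (fun t => z (eP.symm t).1) ᵥ* ((wideBlock S p q eP eC).submatrix id y₀.succAbove) = 0 := by
      funext k
      have := congrFun hw (y₀.succAbove k)
      rw [Pi.zero_apply] at this ⊢
      rw [← this]
      rfl
    have hz' := Matrix.eq_zero_of_vecMul_eq_zero hEmin hw'
    funext i
    by_cases hi : p i
    · have := congrFun hz' (eP ⟨i, hi⟩)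
      simpa using this
    · exact hz i hi
  · -- α at the anchor coordinate is ± the nonzero minor
    rw [blockCofactorRow_of_neg S p q eA eQ (eA.symm x₀).2]
    have : eA ⟨(eA.symm x₀).1, (eA.symm x₀).2⟩ = x₀ := by simp
    rw [this]
    exact (rowCofactor_ne_zero_iff _ _).mpr hA
  · -- proportionality at the anchor coordinate, from the line lemma on the tall block
    intro x hxp hxq
    have hx' := vecMul_tallBlock_eq_zero S p q eA eQ x hxp hxq
    have hα' := rowCofactor_vecMul (tallBlock S p q eA eQ)
    have hl := vecMul_line_of_minor_ne_zero (tallBlock S p q eA eQ) x₀ hA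
      (Matrix.rowCofactor (tallBlock S p q eA eQ)) (fun t => x (eA.symm t).1) hα' hx'
    -- hl : rowCof x₀ • x' = x' x₀ • rowCof
    funext i
    simp only [Pi.smul_apply, smul_eq_mul]
    by_cases hi : p i
    · rw [hxp i hi, blockCofactorRow_of_pos S p q eA eQ hi, mul_zero, mul_zero]
    · have := congrFun hl (eA ⟨i, hi⟩)
      simp only [Pi.smul_apply, smul_eq_mul, Equiv.symm_apply_apply] at this
      rw [blockCofactorRow_of_neg S p q eA eQ (eA.symm x₀).2, blockCofactorRow_of_neg S p q eA eQ hi]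
      have e1 : eA ⟨(eA.symm x₀).1, (eA.symm x₀).2⟩ = x₀ := by simp
      rw [e1]
      exact this

end Minors

end Summit.ValiantsHypothesis.ValiantsHypothesis.Theorems.BarrierLever.AnchoredPeeling
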